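import Literature.NumberTheory.Automorphic.GLnTwoBlockBoxAdLIntegral
import Literature.MeasureTheory.Group.InvariantQuotientChainRule
import HarnessLib

/-!
# Parabolic descent of orbital integrals on `GL_n(F)` at a `(G, M)`-regular element of the Levi
# subgroup: `∫_{G ⧸ T} F(y γ y⁻¹) = C ‖det(1 - K_γ)‖_F⁻¹ ‖det K_γ‖_F ∫_{M_c ⧸ T} ∫_{K × U_c} F(k (mγm⁻¹ u) k⁻¹)`

Topic `NumberTheory/Automorphic`; namespace `Literature.NumberTheory.Automorphic`. KERNEL
mathematics only: theorems, no definition, no named fact, no instance, no `sorry`. Road «D-S1»,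
letter D-S1c (Rogawski 1990, Lemma 4.13.1 (a) p. 69 and its proof p. 70: for `γ ∈ M` with
`G_γ ⊆ M`, `Φ^G(γ, f) = |D_{G/M}(γ)|^{-1/2} Φ^M(γ, f̄^P)`, `f̄^P(m) = δ_P(m)^{1/2} ∫_K ∫_N f(k⁻¹ m n k)`;
Harish-Chandra – van Dijk). Setting: `G = GL_n(F)`, `F` a non-archimedean local field,
`c : Fin n → Bool` a monotone two-block labelling, `M = M_c` the standard Levi subgroup, `U_c` the
unipotent radical, `K = GL_n(𝒪)`, `T ≤ M` a CLOSED subgroup centralising `γ ∈ M` (for a `G`-regular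
`γ`: `T = C_G(γ)`, a maximal torus of `M`), `K_γ` the matrix of `Ad(γ)` on the box `𝔲 ≅ F^{I × J}`.

* `measurable_innerLIntegral` — the inner fibre integral of a Borel function is Borel
  (`measurable_quotient_iff`: on `G ⧸ L` the Borel σ-algebra is the quotient σ-algebra).
* `exists_lintegral_descConj_eq_mul_lintegral_levi` — **the descent**: there is ONE `C ∈ (0, ∞)`
  (depending on the five measures only) such that for every `p ∈ P_c(F)` lying in `M`, centralised
  by `T`, with `det(1 - K_p) ≠ 0`, and every Borel `F : G → [0, ∞]`,

    `∫⁻_{G ⧸ T} F(y p y⁻¹) dμ_{G/T}(y)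
       = C ‖det(1 - K_p)‖_F⁻¹ ‖det K_p‖_F ∫⁻_{M ⧸ T} ( ∫⁻_{K × U_c} F(k (m p m⁻¹ u) k⁻¹) d(κ ⊗ μ_U) ) dμ_{M/T}(m)`

  (integration in stages `G ⧸ T → G ⧸ M` = `exists_lintegral_eq_mul_lintegral_innerLIntegral`, the
  Iwasawa form of `μ_{G/M}` = `exists_quotientMeasure_levi_eq_smul_map_bool`, Tonelli, and the two
  substitutions of `GLnTwoBlockBoxAdLIntegral` at `m p m⁻¹`, whose Jacobians are those of `p`). In
  print's notation the right side is `|D_{G/M}(γ)|^{-1/2} Φ^M(γ, f̄^P)` up to the normalisation of the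
  measures (`‖det(1 - K_γ)‖⁻¹ ‖det K_γ‖ = |D_{G/M}(γ)|^{-1/2} δ_P(γ)^{1/2}`, see the dictionary in
  `GLnBlockScalarOrbitalIntegral`); `ℝ≥0∞`-valued, so no convergence hypothesis on orbital integrals
  is needed.
* `lintegral_descConj_eq_mul_of_forall_conj_eq` («D-S1c⁰») — at an `M`-central `γ` (the singular block
  scalar `diag(e₁ 1_I, e₂ 1_J)`) the `M`-side integral is `Ψ(γ) · μ_{M/T}(M ⧸ T)`.

## References

* [Rogawski1990] J. D. Rogawski, *Automorphic Representations of Unitary Groups in Three Variables*,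
  Ann. of Math. Stud. 123 (1990), §4.13, Lemma 4.13.1 (a) and proof, pp. 69–70.
* [Folland1995] G. B. Folland, *A Course in Abstract Harmonic Analysis* (1995), §2.6 Thm. 2.49.
-/

noncomputable section

open scoped MatrixGroups NNReal ENNReal
open MeasureTheory Measure Matrix Topology

namespace Literature.NumberTheory.Automorphic

open Literature.MeasureTheory.Group
open Literature.NumberTheory.GaloisRepresentations.IsNonarchimedeanLocalField

/-! ### The descent `G ⧸ T → G ⧸ M_c → K × U_c` -/

section MeasurableInner

variable {G : Type*} [Group G] [TopologicalSpace G] [IsTopologicalGroup G] [LocallyCompactSpace G]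
  [SecondCountableTopology G] [T2Space G] [MeasurableSpace G] [BorelSpace G] (H L : Subgroup G)
  [MeasurableSpace (G ⧸ H)] [BorelSpace (G ⧸ H)] [MeasurableSpace (G ⧸ L)] [BorelSpace (G ⧸ L)]
  [MeasurableSpace (L ⧸ H.subgroupOf L)] [BorelSpace (L ⧸ H.subgroupOf L)]
  (μLH : Measure (L ⧸ H.subgroupOf L)) [SMulInvariantMeasure L (L ⧸ H.subgroupOf L) μLH] [SFinite μLH]

/-- **The inner fibre integral of a Borel function is Borel**: `y ↦ ∫_{L ⧸ H⊓L} f(g • ℓH) dμ_{L/H}`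
(`y = gL`) is measurable on `G ⧸ L` for `L` closed and Borel `f : G ⧸ H → [0, ∞]` — its lift to `G` is
a parametrised `lintegral` of a jointly measurable function (`Measurable.lintegral_prod_right'`), and
on `G ⧸ L` the Borel σ-algebra is the quotient σ-algebra (`measurable_quotient_iff`). (Folland 1995,
§2.6, proof of Thm. 2.49: measurability of the fibre integrals in Weil's formula.)
[cite: Folland1995, §2.6 Thm. 2.49] -/
theorem measurable_innerLIntegral (hL : IsClosed (L : Set G)) {f : G ⧸ H → ℝ≥0∞}
    (hf : Measurable f) : Measurable (innerLIntegral H L μLH f) := by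
  rw [measurable_quotient_iff hL]
  have hfun : (innerLIntegral H L μLH f ∘ (QuotientGroup.mk : G → G ⧸ L)) =
      fun g => ∫⁻ z, f (g • inclQuot H L z) ∂μLH := by
    funext g; exact innerLIntegral_mk H L μLH f g
  rw [hfun]
  refine Measurable.lintegral_prod_right' (f := fun r : G × (L ⧸ H.subgroupOf L) =>
    f (r.1 • inclQuot H L r.2)) (hf.comp ?_)
  exact (continuous_fst.smul ((continuous_inclQuot H L).comp continuous_snd)).measurable

end MeasurableInner

section Descent

variable (F : Type*) [Field F] [ValuativeRel F] [TopologicalSpace F] [IsNonarchimedeanLocalField F]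
  [MeasurableSpace F] [BorelSpace F]
  {n : ℕ} {c : Fin n → Bool} [MeasurableSpace (GL (Fin n) F)] [BorelSpace (GL (Fin n) F)]

omit [MeasurableSpace F] [BorelSpace F] [MeasurableSpace (GL (Fin n) F)] [BorelSpace (GL (Fin n) F)] in
/-- A Haar measure on `U_c(F) ≅ F^{I × J}` is s-finite. [folklore] -/
private theorem sFinite_haar_unipotentRadicalGL_aux
    [MeasurableSpace ↥(unipotentRadicalGL F c)] [BorelSpace ↥(unipotentRadicalGL F c)]
    (ν : Measure ↥(unipotentRadicalGL F c)) [IsHaarMeasure ν] : SFinite ν := by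
  haveI : T2Space F := (isLocalField F).toT2Space
  haveI : SecondCountableTopology F := secondCountableTopology_localField F
  haveI : LocallyCompactSpace F := (isLocalField F).toLocallyCompactSpace
  obtain ⟨Φ, -, -⟩ := exists_boxHomeomorph_unipotentRadicalGL (R := F) c
  haveI := Φ.symm.isClosedEmbedding.locallyCompactSpace
  haveI := Φ.symm.secondCountableTopology
  infer_instance

/-- **Parabolic descent of the orbital integrand on `GL_n(F)`** (Rogawski 1990, Lemma 4.13.1 (a)
and its proof, pp. 69–70: `Φ^G(γ, f) = |D_{G/M}(γ)|^{-1/2} Φ^M(γ, f̄^P)`). Let `c : Fin n → Bool` be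
monotone, `M = M_c` (`hM`), `T ≤ M` a closed subgroup, `μ_{G/T}`, `μ_{G/M}` non-zero `G`-invariant
Radon measures, `μ_{M/T}` a non-zero `M`-invariant Radon measure on `M ⧸ T`, `κ`, `μ_U` Haar measures
on `K = GL_n(𝒪)` and `U_c(F)`. There is ONE constant `C ∈ (0, ∞)` such that for every `p ∈ P_c(F)`
with `p ∈ M`, centralised by `T`, with `det(1 - K_p) ≠ 0`, and every Borel `F : GL_n(F) → [0, ∞]`:
**`∫⁻_{G ⧸ T} F(y p y⁻¹) dμ_{G/T} = C ‖det(1 - K_p)‖⁻¹ ‖det K_p‖ ∫⁻_{M ⧸ T} ∫⁻_{K × U_c} F(k ((m p m⁻¹) u) k⁻¹) d(κ ⊗ μ_U) dμ_{M/T}(m)`**,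
the inner double integral being the (unnormalised) constant term `F^P` at `m p m⁻¹` and the outer one
its orbital integral on `M` (`descConj` on `↥M`). [cite: Rogawski1990, §4.13, Lemma 4.13.1 (a), pp. 69–70] -/
theorem exists_lintegral_descConj_eq_mul_lintegral_levi (hc : Monotone c)
    {M : Subgroup (GL (Fin n) F)} (hM : M = standardLeviGL F c)
    {T : Subgroup (GL (Fin n) F)} (hT : IsClosed (T : Set (GL (Fin n) F))) (hTM : T ≤ M)
    [MeasurableSpace (GL (Fin n) F ⧸ T)] [BorelSpace (GL (Fin n) F ⧸ T)]
    [MeasurableSpace (GL (Fin n) F ⧸ M)] [BorelSpace (GL (Fin n) F ⧸ M)]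
    [MeasurableSpace (↥M ⧸ T.subgroupOf M)] [BorelSpace (↥M ⧸ T.subgroupOf M)]
    (μGT : Measure (GL (Fin n) F ⧸ T)) [SMulInvariantMeasure (GL (Fin n) F) (GL (Fin n) F ⧸ T) μGT]
    [IsFiniteMeasureOnCompacts μGT] (hGT : μGT ≠ 0)
    (μGM : Measure (GL (Fin n) F ⧸ M)) [SMulInvariantMeasure (GL (Fin n) F) (GL (Fin n) F ⧸ M) μGM]
    [IsFiniteMeasureOnCompacts μGM] (hGM : μGM ≠ 0)
    (μMT : Measure (↥M ⧸ T.subgroupOf M)) [SMulInvariantMeasure ↥M (↥M ⧸ T.subgroupOf M) μMT]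
    [IsFiniteMeasureOnCompacts μMT] (hMT : μMT ≠ 0)
    (κ : Measure ↥(glInt n F)) [IsHaarMeasure κ]
    (μN : Measure ↥(unipotentRadicalGL F c)) [IsHaarMeasure μN] :
    ∃ C : ℝ≥0∞, C ≠ 0 ∧ C ≠ ∞ ∧ ∀ (p : standardParabolicGL F c) (hpM : (p : GL (Fin n) F) ∈ M)
      (hpT : ∀ t ∈ T, t * (p : GL (Fin n) F) = (p : GL (Fin n) F) * t)
      (_hp : (1 - Matrix.of fun q q' : {i : Fin n // c i = false} × {j : Fin n // c j = true} =>
          ((p : GL (Fin n) F) : Matrix (Fin n) (Fin n) F) q.1 q'.1 *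
            (((p⁻¹ : standardParabolicGL F c) : GL (Fin n) F) : Matrix (Fin n) (Fin n) F) q'.2 q.2).det
          ≠ 0)
      (Fn : GL (Fin n) F → ℝ≥0∞), Measurable Fn →
        ∫⁻ y, descConj (p : GL (Fin n) F) T hpT Fn y ∂μGT =
          C * ((normAbs F ((1 - Matrix.of
              fun q q' : {i : Fin n // c i = false} × {j : Fin n // c j = true} =>
                ((p : GL (Fin n) F) : Matrix (Fin n) (Fin n) F) q.1 q'.1 *
                  (((p⁻¹ : standardParabolicGL F c) : GL (Fin n) F) : Matrix (Fin n) (Fin n) F)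
                    q'.2 q.2).det)⁻¹ *
            normAbs F (Matrix.of
              fun q q' : {i : Fin n // c i = false} × {j : Fin n // c j = true} =>
                ((p : GL (Fin n) F) : Matrix (Fin n) (Fin n) F) q.1 q'.1 *
                  (((p⁻¹ : standardParabolicGL F c) : GL (Fin n) F) : Matrix (Fin n) (Fin n) F)
                    q'.2 q.2).det : ℝ≥0) : ℝ≥0∞) *
          ∫⁻ z, descConj (⟨(p : GL (Fin n) F), hpM⟩ : ↥M) (T.subgroupOf M)
              (fun t ht => Subtype.ext (hpT (t : GL (Fin n) F) ht))
              (fun m : ↥M => ∫⁻ q : ↥(glInt n F) × ↥(unipotentRadicalGL F c),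
                Fn ((q.1 : GL (Fin n) F) * ((m : GL (Fin n) F) * (q.2 : GL (Fin n) F)) *
                  (q.1 : GL (Fin n) F)⁻¹) ∂(κ.prod μN))
              z ∂μMT := by
  subst hM
  haveI : T2Space F := (isLocalField F).toT2Space
  haveI : SecondCountableTopology F := secondCountableTopology_localField F
  haveI : LocallyCompactSpace F := (isLocalField F).toLocallyCompactSpace
  haveI : SecondCountableTopology (Matrix (Fin n) (Fin n) F) :=
    inferInstanceAs (SecondCountableTopology (Fin n → Fin n → F))
  haveI : SecondCountableTopology (Matrix (Fin n) (Fin n) F)ᵐᵒᵖ :=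
    MulOpposite.opHomeomorph.symm.secondCountableTopology
  haveI : SecondCountableTopology (GL (Fin n) F) :=
    Units.isEmbedding_embedProduct.secondCountableTopology
  haveI : LocallyCompactSpace (Matrix (Fin n) (Fin n) F) :=
    inferInstanceAs (LocallyCompactSpace (Fin n → Fin n → F))
  haveI : LocallyCompactSpace (GL (Fin n) F) := inferInstance
  haveI : IsClosed (T : Set (GL (Fin n) F)) := hT
  haveI : IsClosed ((standardLeviGL F c : Subgroup (GL (Fin n) F)) : Set (GL (Fin n) F)) :=
    isClosed_standardLeviGL (R := F) c
  haveI : BorelSpace ↥(unipotentRadicalGL F c) := Subtype.borelSpace _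
  haveI : BorelSpace ↥(glInt n F) := Subtype.borelSpace _
  haveI : CompactSpace ↥(glInt n F) := isCompact_iff_compactSpace.1 (isCompact_glInt n F)
  haveI : IsFiniteMeasure κ := CompactSpace.isFiniteMeasure
  haveI : SFinite μN := sFinite_haar_unipotentRadicalGL_aux F μN
  -- `μ_{M/T}` is s-finite (Radon on a second countable space)
  haveI : SecondCountableTopology ↥(standardLeviGL F c) :=
    TopologicalSpace.Subtype.secondCountableTopology _
  haveI : SecondCountableTopology (↥(standardLeviGL F c) ⧸ T.subgroupOf (standardLeviGL F c)) :=
    inferInstance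
  haveI : LocallyCompactSpace ↥(standardLeviGL F c) :=
    (isClosed_standardLeviGL (R := F) c).locallyCompactSpace
  haveI : SFinite μMT := inferInstance
  haveI : SecondCountableTopology ↥(glInt n F) := TopologicalSpace.Subtype.secondCountableTopology _
  haveI : SecondCountableTopology ↥(unipotentRadicalGL F c) :=
    TopologicalSpace.Subtype.secondCountableTopology _
  haveI : BorelSpace (↥(glInt n F) × ↥(unipotentRadicalGL F c)) := Prod.borelSpace
  haveI : BorelSpace ((↥(glInt n F) × ↥(unipotentRadicalGL F c)) ×
      (↥(standardLeviGL F c) ⧸ T.subgroupOf (standardLeviGL F c))) := Prod.borelSpace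
  -- (1) integration in stages, (2) the Iwasawa form of `μ_{G/M}`
  obtain ⟨c₁, hc₁, hc₁', hchain⟩ := exists_lintegral_eq_mul_lintegral_innerLIntegral T
    (standardLeviGL F c) μGT μGM μMT hTM hGT hGM hMT
  obtain ⟨C, hC, hμGM⟩ := exists_quotientMeasure_levi_eq_smul_map_bool F hc rfl μGM hGM κ μN
  refine ⟨c₁ * C, mul_ne_zero hc₁ (ENNReal.coe_ne_zero.2 hC), ENNReal.mul_ne_top hc₁' ENNReal.coe_ne_top,
    fun p hpM hpT hp Fn hFn => ?_⟩
  have hπ : Measurable fun q : ↥(glInt n F) × ↥(unipotentRadicalGL F c) =>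
      (QuotientGroup.mk ((q.1 : GL (Fin n) F) * (q.2 : GL (Fin n) F)) :
        GL (Fin n) F ⧸ standardLeviGL F c) :=
    ((QuotientGroup.continuous_mk (N := standardLeviGL F c)).comp
      ((continuous_subtype_val.comp continuous_fst).mul
        (continuous_subtype_val.comp continuous_snd))).measurable
  have hf : Measurable (descConj (p : GL (Fin n) F) T hpT Fn) := measurable_descConj _ _ _ hFn
  rw [hchain _ hf, hμGM, lintegral_smul_measure,
    lintegral_map (measurable_innerLIntegral T (standardLeviGL F c) μMT
      (isClosed_standardLeviGL (R := F) c) hf) hπ]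
  have hmk : ∀ q : ↥(glInt n F) × ↥(unipotentRadicalGL F c),
      innerLIntegral T (standardLeviGL F c) μMT (descConj (p : GL (Fin n) F) T hpT Fn)
        (QuotientGroup.mk ((q.1 : GL (Fin n) F) * (q.2 : GL (Fin n) F))) =
      ∫⁻ z, descConj (p : GL (Fin n) F) T hpT Fn
        (((q.1 : GL (Fin n) F) * (q.2 : GL (Fin n) F)) • inclQuot T (standardLeviGL F c) z) ∂μMT :=
    fun q => innerLIntegral_mk _ _ _ _ _
  rw [lintegral_congr hmk]
  -- (3) Tonelli: swap `K × U_c` and `M ⧸ T`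
  have hjoint : Measurable fun r : (↥(glInt n F) × ↥(unipotentRadicalGL F c)) ×
      (↥(standardLeviGL F c) ⧸ T.subgroupOf (standardLeviGL F c)) =>
      descConj (p : GL (Fin n) F) T hpT Fn
        (((r.1.1 : GL (Fin n) F) * (r.1.2 : GL (Fin n) F)) • inclQuot T (standardLeviGL F c) r.2) :=
    hf.comp ((((continuous_subtype_val.comp continuous_fst).mul
      (continuous_subtype_val.comp continuous_snd)).comp continuous_fst).smul
      ((continuous_inclQuot T (standardLeviGL F c)).comp continuous_snd)).measurable
  rw [lintegral_lintegral_swap hjoint.aemeasurable]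
  -- (4) the inner `K × U_c` integral at `z = mT`: the two substitutions at `m p m⁻¹`
  have hinner : ∀ z : ↥(standardLeviGL F c) ⧸ T.subgroupOf (standardLeviGL F c),
      ∫⁻ q : ↥(glInt n F) × ↥(unipotentRadicalGL F c), descConj (p : GL (Fin n) F) T hpT Fn
          (((q.1 : GL (Fin n) F) * (q.2 : GL (Fin n) F)) • inclQuot T (standardLeviGL F c) z)
            ∂(κ.prod μN) =
        ((normAbs F ((1 - Matrix.of
              fun q q' : {i : Fin n // c i = false} × {j : Fin n // c j = true} =>
                ((p : GL (Fin n) F) : Matrix (Fin n) (Fin n) F) q.1 q'.1 *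
                  (((p⁻¹ : standardParabolicGL F c) : GL (Fin n) F) : Matrix (Fin n) (Fin n) F)
                    q'.2 q.2).det)⁻¹ *
            normAbs F (Matrix.of
              fun q q' : {i : Fin n // c i = false} × {j : Fin n // c j = true} =>
                ((p : GL (Fin n) F) : Matrix (Fin n) (Fin n) F) q.1 q'.1 *
                  (((p⁻¹ : standardParabolicGL F c) : GL (Fin n) F) : Matrix (Fin n) (Fin n) F)
                    q'.2 q.2).det : ℝ≥0) : ℝ≥0∞) *
          descConj (⟨(p : GL (Fin n) F), hpM⟩ : ↥(standardLeviGL F c))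
            (T.subgroupOf (standardLeviGL F c)) (fun t ht => Subtype.ext (hpT (t : GL (Fin n) F) ht))
            (fun m : ↥(standardLeviGL F c) => ∫⁻ q : ↥(glInt n F) × ↥(unipotentRadicalGL F c),
              Fn ((q.1 : GL (Fin n) F) * ((m : GL (Fin n) F) * (q.2 : GL (Fin n) F)) *
                (q.1 : GL (Fin n) F)⁻¹) ∂(κ.prod μN)) z := by
    intro z
    induction z using QuotientGroup.induction_on with
    | H m =>
      -- `m p m⁻¹` as an element of `P_c`
      obtain ⟨mP, hmP⟩ : ∃ mP : standardParabolicGL F c, (mP : GL (Fin n) F) = (m : GL (Fin n) F) :=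
        ⟨⟨(m : GL (Fin n) F), standardLeviGL_le F c m.2⟩, rfl⟩
      have hconj_coe : ((mP * p * mP⁻¹ : standardParabolicGL F c) : GL (Fin n) F) =
          (m : GL (Fin n) F) * (p : GL (Fin n) F) * (m : GL (Fin n) F)⁻¹ := by
        rw [Subgroup.coe_mul, Subgroup.coe_mul, Subgroup.coe_inv, hmP]
      have hcoeM : ((m * ⟨(p : GL (Fin n) F), hpM⟩ * m⁻¹ : ↥(standardLeviGL F c)) : GL (Fin n) F) =
          (m : GL (Fin n) F) * (p : GL (Fin n) F) * (m : GL (Fin n) F)⁻¹ := by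
        rw [Subgroup.coe_mul, Subgroup.coe_mul, Subgroup.coe_inv]
      have hpt : ∀ q : ↥(glInt n F) × ↥(unipotentRadicalGL F c),
          descConj (p : GL (Fin n) F) T hpT Fn
            (((q.1 : GL (Fin n) F) * (q.2 : GL (Fin n) F)) •
              inclQuot T (standardLeviGL F c) (QuotientGroup.mk m)) =
          Fn ((q.1 : GL (Fin n) F) * (q.2 : GL (Fin n) F) * ((mP * p * mP⁻¹ : standardParabolicGL F c) :
              GL (Fin n) F) * ((q.1 : GL (Fin n) F) * (q.2 : GL (Fin n) F))⁻¹) := by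
        intro q
        rw [inclQuot_mk, MulAction.Quotient.smul_mk, smul_eq_mul, descConj_mk, hconj_coe]
        congr 1
        simp only [_root_.mul_inv_rev]
        group
      rw [lintegral_congr hpt, lintegral_prod_unipotent_conj_eq_mul κ
          (fun k : ↥(glInt n F) => (k : GL (Fin n) F)) μN (mP * p * mP⁻¹)
          (by rw [det_one_sub_boxAd_conj_eq]; exact hp),
        lintegral_prod_unipotent_mul_parabolic_eq_mul κ (fun k : ↥(glInt n F) => (k : GL (Fin n) F)) μN
          (mP * p * mP⁻¹),
        det_one_sub_boxAd_conj_eq, det_boxAd_conj_eq, descConj_mk, ← mul_assoc, ENNReal.coe_mul]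
      simp only [hconj_coe, hcoeM]
  rw [lintegral_congr hinner, lintegral_const_mul' _ _ ENNReal.coe_ne_top, ENNReal.smul_def,
    smul_eq_mul, ← mul_assoc, ← mul_assoc]

end Descent

/-! ### «D-S1c⁰»: at an `M`-central point the `M`-side orbital integrand is constant -/

section Central

variable {L : Type*} [Group L]

/-- **At an `M`-central element the `M`-side orbital integral is a volume times a value**: if
`m γ m⁻¹ = γ` for all `m ∈ L` then `descConj γ H _ Ψ ≡ Ψ γ`, so
`∫⁻_{L ⧸ H} descConj γ H _ Ψ dμ = Ψ(γ) · μ(L ⧸ H)`. With `L = M_c`, `γ = diag(e₁ 1_I, e₂ 1_J)` and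
`Ψ = F^P` the constant term, the right side of `exists_lintegral_descConj_eq_mul_lintegral_levi` at the
singular `(G, M)`-regular block scalar is `C ‖det(1 - K_γ)‖⁻¹ ‖det K_γ‖ μ_{M/T}(M ⧸ T) F^P(γ)`
(Rogawski 1990, §4.13: `H_γ = M` at the `(G, H)`-regular singular `γ`).
[cite: Rogawski1990, §4.13, proof of Lemma 4.13.1, p. 70] -/
theorem lintegral_descConj_eq_mul_of_forall_conj_eq (H : Subgroup L) (γ : L)
    (hH : ∀ h ∈ H, h * γ = γ * h) (hγ : ∀ m : L, m * γ * m⁻¹ = γ)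
    [MeasurableSpace (L ⧸ H)] (μ : Measure (L ⧸ H)) (Ψ : L → ℝ≥0∞) :
    ∫⁻ z, descConj γ H hH Ψ z ∂μ = Ψ γ * μ Set.univ := by
  have h : ∀ z, descConj γ H hH Ψ z = Ψ γ := fun z => by
    induction z using QuotientGroup.induction_on with
    | H m => rw [descConj_mk, hγ]
  simp_rw [h]
  rw [lintegral_const]

end Central

end Literature.NumberTheory.Automorphic
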